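import Literature.Analysis.FluidPDE.QuasiSelfSimilarMoveSP10Checks1
import Literature.Analysis.FluidPDE.QuasiSelfSimilarMoveSP10Checks2
import Literature.Analysis.FluidPDE.QuasiSelfSimilarMoveSC
import HarnessLib

/-!
# Straight move, phase 10: assembled checks and the slot

Topic `Literature/Analysis/FluidPDE`. Emitted data / kernel certificates of the explicit straight generating
move (`S`) in the typed-chain model, under the contract of `PlanarGeneratorAssembly.lean`
(`acm_compatible_blocks_of_slots`). Generated by the author's emitter from the exact rational design;
no named facts, every theorem is decided in the kernel or assembled from decided chunks. [folklore]

## References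

* G. Alberti, G. Crippa, A. L. Mazzucato, *Exponential self-similar mixing by incompressible
  flows*, J. Amer. Math. Soc. 32 (2019), 445–490, §8 (arXiv:1605.02090).
-/

noncomputable section

namespace Literature.Analysis.FluidPDE.QuasiSelfSimilar.MoveS

open PlanarKinematics QuasiSelfSimilar

set_option maxHeartbeats 4000000 in
/-- Node count. [folklore] -/
theorem P10_K : P10.K = 85 := by decide +kernel

/-- Kernel check of element validity (all nodes). [folklore] -/
theorem P10_valid : ∀ k < 85, (P10.node k).e.validB = true :=
  (forall_lt_of_chunk (forall_lt_of_chunk (forall_lt_of_chunk (forall_lt_zero fun k => (P10.node k).e.validB = true) P10_valid_c0) P10_valid_c1) P10_valid_c2)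

/-- Kernel check of positivity (all nodes). [folklore] -/
theorem P10_pos : ∀ k < 85, (decide (0 < (P10.node k).box.ρ) && decide (0 < (P10.node k).step.len)) = true :=
  (forall_lt_of_chunk (forall_lt_of_chunk (forall_lt_of_chunk (forall_lt_zero fun k => (decide (0 < (P10.node k).box.ρ) && decide (0 < (P10.node k).step.len)) = true) P10_pos_c0) P10_pos_c1) P10_pos_c2)

/-- Kernel check of the node geometry (orders, pieces, cover tags) (all nodes). [folklore] -/
theorem P10_geo : ∀ k < 85, P10.geomAtB k = true :=
  (forall_lt_of_chunk (forall_lt_of_chunk (forall_lt_of_chunk (forall_lt_zero fun k => P10.geomAtB k = true) P10_geo_c0) P10_geo_c1) P10_geo_c2)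

/-- Kernel check of box separation rows (all nodes). [folklore] -/
theorem P10_sep : ∀ k < 85, P10.sepRowB k = true :=
  (forall_lt_of_chunk (forall_lt_of_chunk (forall_lt_of_chunk (forall_lt_zero fun k => P10.sepRowB k = true) P10_sep_c0) P10_sep_c1) P10_sep_c2)

/-- Kernel check of junction agreement (all nodes). [folklore] -/
theorem P10_agr : ∀ k < 85, P10.agreeAtB k = true :=
  (forall_lt_of_chunk (forall_lt_of_chunk (forall_lt_of_chunk (forall_lt_zero fun k => P10.agreeAtB k = true) P10_agr_c0) P10_agr_c1) P10_agr_c2)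

/-- `elemsValidB` of phase 10. [folklore] -/
theorem P10_elemsValidB : P10.elemsValidB = true :=
  PhaseQ.elemsValidB_of_forall (by decide +kernel) (by rw [P10_K]; exact P10_valid)

/-- `allPosB` of phase 10. [folklore] -/
theorem P10_allPosB : P10.allPosB = true :=
  PhaseQ.allPosB_of_forall (by rw [P10_K]; exact P10_pos)

/-- `geomB` of phase 10. [folklore] -/
theorem P10_geomB : P10.geomB = true :=
  PhaseQ.geomB_of_geomAtB P10_elemsValidB P10_allPosB (by rw [P10_K]; exact P10_geo)

/-- `boxSepB` of phase 10. [folklore] -/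
theorem P10_boxSepB : P10.boxSepB = true :=
  PhaseQ.boxSepB_of_sepRowB (by rw [P10_K]; exact P10_sep)

/-- `agreeB` of phase 10. [folklore] -/
theorem P10_agreeB : P10.agreeB = true :=
  PhaseQ.agreeB_of_agreeAtB (by rw [P10_K]; exact P10_agr)

set_option maxHeartbeats 4000000 in
/-- `gateOKB` of phase 10 on its slot. [folklore] -/
theorem P10_gateOKB : P10.gateOKB C_S stub10 (mkRat (2) 3) = true := by decide +kernel

/-- Slot 10 of the straight move. [folklore] -/
def slot10 : Slot := ⟨P10, (mkRat (2) 3), stub10, rc10, rc10'⟩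
/-- Slot test of slot 10. [folklore] -/
theorem slot10_okB : slot10.okB C_S (genGate .S) (mkRat (3) 200) = true :=
  Slot.okB_intro (s := slot10) P10_geomB P10_boxSepB P10_agreeB P10_gateOKB rfl (by decide)

end Literature.Analysis.FluidPDE.QuasiSelfSimilar.MoveS

end
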